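import Summits.ValiantsHypothesis.ValiantsHypothesis.Theorems.KPlusLogSqLawStaticPathFoldDefs

/-!
# Route «KPlusLogSqLaw» — the ALTERNATING FOLD LEMMA (degeneracy-free form of STATIC-PATH-NLOGN §4 (P2))

HONEST FRAMING.  Helper toward the crux `WeakLifting` (item `stmt-ValiantsHypothesis-19561`, route `KPlusLogSqLaw`,
cell `pub-symmetroid`, seat val-sym-lift-p3 g6, 2026-08-27), on the line of its registered witness-plan stub
`stub_tridiagonalSectorB` (real symmetric TRIDIAGONAL lacunary pencils).  The TROPICAL TWIN of the STATIC tridiagonal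
sector is parametric maximum-weight matching on a path (val-sym-lift-p4 g6, `HOME/val-sym-lift-p4/STATIC-PATH-NLOGN.md`,
evidence on 19561): items `1..n` (the path edges; consecutive items conflict) with weights `w_t(θ)` linear in the
parameter `θ`; with the signed prefix sums `S_0 = 0`, `S_t = S_{t-1} + (-1)^t w_t` the «left train» of the block is read
off the ALTERNATING FOLD `μ_0 = S_0`, `μ_k = max (S_k, μ_{k-1})` (`k` odd), `μ_k = min (S_k, μ_{k-1})` (`k` even), and the
paper's Theorem P2 «`μ_n` has at most `2n` linear pieces» is the key to its `O(n log n)` bound on the number of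
breakpoints (= dominant terms of the static tridiagonal design).  The paper proof ASSUMES GENERAL POSITION of the lines
(pairwise non-parallel, no three concurrent, no coincident event abscissae) and argues that a perturbation does not
decrease the count.

THIS FILE proves a GENERAL-POSITION-FREE version, with a weaker constant, by an elementary sup/convexity argument:
for ANY `n + 1` affine functions `L t θ = a t * θ + b t` that are pairwise distinct AS FUNCTIONS on the indices `≤ n`
(no other hypothesis), the ACTIVE INDEX of the fold (`lab n θ` = the last index `j ≤ n` at which the fold equals `L j`,
so that `fold n θ = L (lab n θ) θ`, `fold_eq_lab`) changes at most `8 n + 9` times along any strictly increasing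
sequence of parameters (`StaticPathFold.card_changes_le`, in the companion part 2 `KPlusLogSqLawStaticPathFoldCount.lean`).  Mechanism (parts 1–2): the set where the label is
`j` is `Z_j ∩ I_j` with `Z_j = {fold j = L j}` closed and `I_j` = «every later line strictly on its correct side of `L j`»
an OPEN INTERVAL; the supremum of a run of label `j` is either the right endpoint of `I_j` or a point where `L j` meets
the line `L i` active one level down while ALL later lines are weakly on their correct side of `L i` — such a point is
an endpoint of the interval `T_i` of those parameters unless `L i = L j` (`sSup_run_mem`); so all run suprema lie in a
set of `≤ 4 (n + 1)` interval endpoints, and runs give a `2`-to-`1` map into it.  Nothing here is specific to paths: it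
is a statement about `n + 1` lines (definitions in `KPlusLogSqLawStaticPathFoldDefs.lean`).  Nothing in this file asserts
anything about `WeakLifting`, `TropicalB`, `KPlusLogSqLaw`, the stub in its window, `MatrixDescartes` (stmt-18050) or
`VP ≠ VNP`.
-/

set_option linter.dupNamespace false
set_option autoImplicit false

namespace Summit.ValiantsHypothesis.ValiantsHypothesis.Theorems.KPlusLogSqLaw

open Set Classical

namespace StaticPathFold

noncomputable section

variable (a b : ℕ → ℝ)

/-! ## 1. The fold and its active index -/

/-- the active index at level `k` is at most `k`. [folklore] -/
theorem lab_le (k : ℕ) (θ : ℝ) : lab a b k θ ≤ k := Nat.findGreatest_le _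

/-- at the active index the fold equals the new line. [folklore] -/
theorem fold_lab_eq (k : ℕ) (θ : ℝ) : fold a b (lab a b k θ) θ = L a b (lab a b k θ) θ :=
  Nat.findGreatest_spec (P := fun j => fold a b j θ = L a b j θ) (Nat.zero_le k) (fold_zero a b θ)

/-- above the active index the fold never equals the new line. [folklore] -/
theorem fold_ne_of_lab_lt {k t : ℕ} {θ : ℝ} (h1 : lab a b k θ < t) (h2 : t ≤ k) : fold a b t θ ≠ L a b t θ :=
  Nat.findGreatest_is_greatest h1 h2

/-- if the fold at `t+1` does not pick the new line, it keeps the old value. -/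
theorem fold_succ_eq_of_ne {t : ℕ} {θ : ℝ} (h : fold a b (t + 1) θ ≠ L a b (t + 1) θ) :
    fold a b (t + 1) θ = fold a b t θ := by
  rw [fold_succ] at h ⊢
  split_ifs with he
  · rw [if_pos he] at h
    rcases min_choice (L a b (t + 1) θ) (fold a b t θ) with h1 | h1
    · exact absurd h1 h
    · exact h1
  · rw [if_neg he] at h
    rcases max_choice (L a b (t + 1) θ) (fold a b t θ) with h1 | h1
    · exact absurd h1 h
    · exact h1

/-- if the fold at `t+1` does not pick the new line, the new line is strictly on its correct side. [folklore] -/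
theorem dom_of_fold_succ_ne {t : ℕ} {θ : ℝ} (h : fold a b (t + 1) θ ≠ L a b (t + 1) θ) :
    0 < gap (t + 1) (fold a b t θ) (L a b (t + 1) θ) := by
  have h2 := fold_succ_eq_of_ne a b h
  unfold gap
  rw [fold_succ] at h h2
  split_ifs with he
  · rw [if_pos he] at h h2
    have h3 : fold a b t θ ≤ L a b (t + 1) θ := h2 ▸ min_le_left _ _
    rw [h2] at h
    exact sub_pos.mpr (lt_of_le_of_ne h3 h)
  · rw [if_neg he] at h h2
    have h3 : L a b (t + 1) θ ≤ fold a b t θ := h2 ▸ le_max_left _ _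
    rw [h2] at h
    exact sub_pos.mpr (lt_of_le_of_ne h3 (Ne.symm h))

/-- above the active index the fold is constant, equal to the active line. -/
theorem fold_eq_of_lab_le {k : ℕ} {θ : ℝ} {t : ℕ} (h1 : lab a b k θ ≤ t) (h2 : t ≤ k) :
    fold a b t θ = L a b (lab a b k θ) θ := by
  induction t with
  | zero =>
    have h0 : lab a b k θ = 0 := Nat.le_zero.mp h1
    rw [h0]; rfl
  | succ t ih =>
    rcases Nat.eq_or_lt_of_le h1 with h3 | h3
    · rw [← h3]; exact fold_lab_eq a b k θ
    · rw [fold_succ_eq_of_ne a b (fold_ne_of_lab_lt a b h3 h2)]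
      exact ih (Nat.lt_succ_iff.mp h3) (Nat.le_of_succ_le h2)

/-- **the fold is the active line.** -/
theorem fold_eq_lab (k : ℕ) (θ : ℝ) : fold a b k θ = L a b (lab a b k θ) θ :=
  fold_eq_of_lab_le a b (lab_le a b k θ) le_rfl

/-- every line above the active index is strictly on its correct side of the active line. -/
theorem dom_of_lab_lt {k t : ℕ} {θ : ℝ} (h1 : lab a b k θ < t) (h2 : t ≤ k) :
    0 < gap t (L a b (lab a b k θ) θ) (L a b t θ) := by
  obtain ⟨t, rfl⟩ : ∃ t', t = t' + 1 := ⟨t - 1, (Nat.succ_pred_eq_of_pos (Nat.lt_of_le_of_lt (Nat.zero_le _) h1)).symm⟩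
  have h3 := dom_of_fold_succ_ne a b (fold_ne_of_lab_lt a b h1 h2)
  rwa [fold_eq_of_lab_le a b (Nat.lt_succ_iff.mp h1) (Nat.le_of_succ_le h2)] at h3

/-- membership in `I k (lab k θ)`. -/
theorem mem_I_lab (k : ℕ) (θ : ℝ) : θ ∈ I a b k (lab a b k θ) :=
  fun _ h1 h2 => dom_of_lab_lt a b h1 h2

/-- **characterisation of the active index**: `fold j = L j` and all later lines strictly placed force `lab = j`. -/
theorem lab_eq_of {k j : ℕ} {θ : ℝ} (hj : j ≤ k) (h1 : fold a b j θ = L a b j θ) (h2 : θ ∈ I a b k j) :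
    lab a b k θ = j := by
  -- the fold stays equal to `L j θ` from level `j` on
  have key : ∀ t, j ≤ t → t ≤ k → fold a b t θ = L a b j θ := by
    intro t
    induction t with
    | zero => intro h3 _; rw [Nat.le_zero.mp h3] at h1 ⊢; exact h1
    | succ t ih =>
      intro h3 h4
      rcases Nat.eq_or_lt_of_le h3 with h5 | h5
      · rw [← h5]; exact h1
      · have h6 := ih (Nat.lt_succ_iff.mp h5) (Nat.le_of_succ_le h4)
        have h7 := h2 (t + 1) h5 h4
        unfold gap at h7
        rw [fold_succ, h6]
        split_ifs with he
        · rw [if_pos he] at h7; exact min_eq_right (sub_pos.mp h7).le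
        · rw [if_neg he] at h7; exact max_eq_right (sub_pos.mp h7).le
  rw [lab, Nat.findGreatest_eq_iff]
  refine ⟨hj, fun _ => h1, fun t h3 h4 h5 => ?_⟩
  have h6 := key t h3.le h4
  have h7 := h2 t h3 h4
  unfold gap at h7
  rw [h5] at h6
  split_ifs at h7 with he
  · rw [h6] at h7; simp at h7
  · rw [h6] at h7; simp at h7

/-- a parameter with active index `j` lies in `Z_j ∩ I_j`. -/
theorem fold_eq_of_lab_eq {k j : ℕ} {θ : ℝ} (h : lab a b k θ = j) : fold a b j θ = L a b j θ := by
  rw [← h]; exact fold_lab_eq a b k θ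

/-! ## 2. Topology: continuity, the open interval `I`, the closed interval `T` -/

/-- lines are continuous. [folklore] -/
theorem continuous_L (t : ℕ) : Continuous (L a b t) := by
  unfold L; fun_prop

/-- the fold is continuous. [folklore] -/
theorem continuous_fold (k : ℕ) : Continuous (fold a b k) := by
  induction k with
  | zero => exact continuous_L a b 0
  | succ k ih =>
    have h : fold a b (k + 1) = fun θ => if Even (k + 1) then min (L a b (k + 1) θ) (fold a b k θ)
        else max (L a b (k + 1) θ) (fold a b k θ) := rfl
    rw [h]
    by_cases he : Even (k + 1)
    · simp only [if_pos he]; exact (continuous_L a b (k + 1)).min ih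
    · simp only [if_neg he]; exact (continuous_L a b (k + 1)).max ih

/-- the signed gap between two lines is a continuous function of the parameter. [folklore] -/
theorem continuous_gap (t i : ℕ) : Continuous fun θ => gap t (L a b i θ) (L a b t θ) := by
  unfold gap
  by_cases he : Even t
  · simp only [if_pos he]; exact (continuous_L a b t).sub (continuous_L a b i)
  · simp only [if_neg he]; exact (continuous_L a b i).sub (continuous_L a b t)

/-- `I n j` as a finite intersection. [folklore] -/
theorem I_eq (n j : ℕ) : I a b n j = ⋂ t ∈ Finset.Ioc j n, {θ | 0 < gap t (L a b j θ) (L a b t θ)} := by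
  ext θ
  simp only [I, mem_setOf_eq, mem_iInter, Finset.mem_Ioc, and_imp]

/-- `I n j` is open. [folklore] -/
theorem isOpen_I (n j : ℕ) : IsOpen (I a b n j) := by
  rw [I_eq]
  exact isOpen_biInter_finset fun t _ => isOpen_lt continuous_const (continuous_gap a b t j)

/-- `T n i` as a finite intersection. [folklore] -/
theorem T_eq (n i : ℕ) : T a b n i = ⋂ t ∈ Finset.Ioc i n, {θ | 0 ≤ gap t (L a b i θ) (L a b t θ)} := by
  ext θ
  simp only [T, mem_setOf_eq, mem_iInter, Finset.mem_Ioc, and_imp]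

/-- `T n i` is closed. [folklore] -/
theorem isClosed_T (n i : ℕ) : IsClosed (T a b n i) := by
  rw [T_eq]
  exact isClosed_biInter fun t _ => isClosed_le continuous_const (continuous_gap a b t i)

/-- `I n j ⊆ T n j`. [folklore] -/
theorem I_subset_T (n j : ℕ) : I a b n j ⊆ T a b n j := fun _ h t h1 h2 => (h t h1 h2).le

/-- the closure of `I n j` lies in `T n j`. [folklore] -/
theorem closure_I_subset_T (n j : ℕ) : closure (I a b n j) ⊆ T a b n j :=
  closure_minimal (I_subset_T a b n j) (isClosed_T a b n j)

/-- the set where the fold at level `j` equals line `j` is closed. [folklore] -/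
theorem isClosed_Z (j : ℕ) : IsClosed {θ : ℝ | fold a b j θ = L a b j θ} :=
  isClosed_eq (continuous_fold a b j) (continuous_L a b j)

/-- an affine expression positive at both ends of a segment is positive inside. [folklore] -/
theorem affine_between_lt {p q x y z : ℝ} (hxy : x ≤ y) (hyz : y ≤ z) (hx : 0 < p * x + q) (hz : 0 < p * z + q) :
    0 < p * y + q := by
  rcases le_or_gt 0 p with hp | hp
  · nlinarith
  · nlinarith

/-- `I n j` is order-connected (an interval). [folklore] -/
theorem ordConnected_I (n j : ℕ) : OrdConnected (I a b n j) := by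
  refine ⟨fun x hx z hz y hy t h1 h2 => ?_⟩
  have hx' := hx t h1 h2
  have hz' := hz t h1 h2
  unfold gap at hx' hz' ⊢
  unfold L at hx' hz' ⊢
  split_ifs at hx' hz' ⊢ with he
  · have := affine_between_lt (p := a t - a j) (q := b t - b j) hy.1 hy.2 (by linarith) (by linarith)
    linarith
  · have := affine_between_lt (p := a j - a t) (q := b j - b t) hy.1 hy.2 (by linarith) (by linarith)
    linarith

/-! ## 3. The endpoint set; a supremum / infimum test -/

/-- the endpoint set has at most `4 (n + 1)` elements. [folklore] -/
theorem card_B_le (n : ℕ) : (B a b n).card ≤ 4 * (n + 1) := by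
  unfold B
  refine (Finset.card_biUnion_le).trans ?_
  have h : ∀ j ∈ Finset.range (n + 1), (endpts a b n j).card ≤ 4 := fun j _ => by
    unfold endpts
    refine (Finset.card_insert_le _ _).trans ?_
    refine Nat.succ_le_succ ((Finset.card_insert_le _ _).trans ?_)
    refine Nat.succ_le_succ ((Finset.card_insert_le _ _).trans ?_)
    rw [Finset.card_singleton]
  calc ∑ j ∈ Finset.range (n + 1), (endpts a b n j).card ≤ ∑ _j ∈ Finset.range (n + 1), 4 :=
        Finset.sum_le_sum h
    _ = 4 * (n + 1) := by rw [Finset.sum_const, Finset.card_range, smul_eq_mul, mul_comm]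

/-- a member of a set of reals which is not strictly between two other members is its infimum or its supremum. [folklore] -/
theorem eq_sInf_or_eq_sSup_of_mem {s : Set ℝ} {r : ℝ} (hr : r ∈ s)
    (h : ¬ ∃ y₁ ∈ s, ∃ y₂ ∈ s, y₁ < r ∧ r < y₂) : r = sInf s ∨ r = sSup s := by
  by_cases h1 : ∃ y₁ ∈ s, y₁ < r
  · -- then no member above `r`: `r` is the greatest element
    right
    have h2 : ∀ y ∈ s, y ≤ r := by
      intro y hy
      by_contra h3
      obtain ⟨y₁, hy₁, hy₁r⟩ := h1
      exact h ⟨y₁, hy₁, y, hy, hy₁r, lt_of_not_ge h3⟩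
    exact (IsGreatest.csSup_eq ⟨hr, h2⟩).symm
  · left
    have h2 : ∀ y ∈ s, r ≤ y := fun y hy => le_of_not_gt fun h3 => h1 ⟨y, hy, h3⟩
    have h3 : IsLeast s r := ⟨hr, h2⟩
    exact (h3.csInf_eq).symm

end

end StaticPathFold

end Summit.ValiantsHypothesis.ValiantsHypothesis.Theorems.KPlusLogSqLaw
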